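import Summits.BirchSwinnertonDyer.BirchSwinnertonDyer.Theorems.ResidualThetaTransportAtTwoResidualSignedLambdaLowerCMAtTwoFourTermOneSided
import Summits.BirchSwinnertonDyer.BirchSwinnertonDyer.Theorems.ResidualThetaTransportAtTwoLambdaLowerBoundOWeierstrass

/-!
# Sketch (stub-ideation k1 g24, «weaken / strengthen», `stub_cmLambdaLower`, crux stmt-BirchSwinnertonDyer-26074)
# THE PACKAGE IS DECORATIVE UNDER `∃`: the algebraic hold child «B» ≡ its `P`-free composite

BSD is NOT proved by anything here; RSL_g (stmt-22608), (R≥)ᵖ (stmt-26074) and the hold KZ_g (stmt-24105) stay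
OPEN / HOLD.  Nothing about any curve or form is asserted: pure algebra over `Λ = A⟦X⟧` (`A` a complete DVR,
`F = Frac A`) on Kato's pinned `𝐇¹_Γ(T)` (`I : IwasawaH1DataCoeff`), λ-currency `dim_F (F ⊗_A ·)`.

WHAT.  The pen's hold-opening scope of record (KZG-HOLD-OPENING-SCOPE-g19.md §2, 2026-08-29T10:00Z) proposes
the algebraic child
  `B(z₀) : ∃ P : ZetaQuotientPackage I, z₀ ∈ P.Z ∧ (∃ c₀ ≠ 0, c₀ • P.Z ⊆ Λ z₀) ∧ P.CharIdealEqUpToConst ∧ λ(P.H2) ≤ λ(Sel₀^∨)`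
labelled «print ([BT26] Thm 2.6 = `P.CharIdealEqUpToConst`) + ONE port (`hPT`)».  Since `P.H2 : Type` is a FIELD
of the package and `P` is `∃`-bound, the TAUTOLOGICAL PACKAGE `P₀ := ⟨H2 := 𝐇¹/Λz₀, Z := Λz₀⟩` discharges the first
three conjuncts for free (`charIdealEqUpToConst_of_eq P₀ rfl`), so

  `B(z₀) ↔ B⁻(z₀) := (𝐇¹_Γ/Λz₀ is Λ-torsion) ∧ λ(𝐇¹_Γ/Λz₀) ≤ λ(Sel₀^∨)`      (`penChildB_iff_compositeB`)

— the WEAKEST SUFFICIENT and the STRONGEST HONESTLY-LABELLED text coincide and are `P`-free; the [BT26]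
conjunct certifies nothing on its own (the tree has no object `𝐇²_Γ(T_ρ)` to pin `P.H2` to), and the (ii)-half
consumer needs no package at all (`ii_clauses_of_compositeB` = k2-g16's `ii_clauses_of_package` minus the package).

§0 instance transport `λ(RestrictScalars A Λ M) = λ(M)` (the only way to say `λ(P.H2)` under `∃ P`);
§1 the two texts; §2 the tautological package and `B⁻ → B`; §3 `B → B⁻` (k2-g16 §1–§2 + the landed one-sided
[BT26] flank `CharIdealLambda.finrank_baseChange_zetaQuotient_le_H2_of_span_C_mul_charIdeal_le`); §4 the consumer.
-/

set_option autoImplicit false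
set_option linter.dupNamespace false

noncomputable section

open scoped TensorProduct Classical

namespace Summit.BirchSwinnertonDyer.BirchSwinnertonDyer.Cruxes.ResidualThetaCountLowerPureAtTwo.SideaK1G24

open Literature.NumberTheory.EllipticCurves Literature.NumberTheory.EllipticCurves.Kato2004
open Literature.NumberTheory.GaloisRepresentations
open Summit.BirchSwinnertonDyer.BirchSwinnertonDyer.Theorems

/-! ## §0 Instance transport: the `RestrictScalars` λ equals the tower λ -/

section Transport

variable {A : Type*} [CommRing A] (F : Type*) [Field F] [Algebra A F]
  {Λ : Type*} [CommRing Λ] [Algebra A Λ] (M : Type*) [AddCommGroup M] [Module Λ M] [Module A M]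
  [IsScalarTower A Λ M]

/-- The identity `RestrictScalars A Λ M ≃ₗ[A] M` when `M` already carries the compatible `A`-structure. [folklore] -/
def restrictScalarsLinearEquiv : RestrictScalars A Λ M ≃ₗ[A] M :=
  { RestrictScalars.addEquiv A Λ M with
    map_smul' := fun a x => by
      simp only [AddEquiv.toFun_eq_coe, RingHom.id_apply]
      rw [RestrictScalars.smul_def, AddEquiv.apply_symm_apply, IsScalarTower.algebraMap_smul] }

/-- `dim_F (F ⊗_A RestrictScalars A Λ M) = dim_F (F ⊗_A M)`. [folklore] -/
theorem finrank_baseChange_restrictScalars_eq :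
    Module.finrank F (F ⊗[A] RestrictScalars A Λ M) = Module.finrank F (F ⊗[A] M) :=
  LinearEquiv.finrank_eq ((restrictScalarsLinearEquiv (A := A) (Λ := Λ) M).baseChange A F _ _)

end Transport

/-! ## §1 The two texts (generic cores; the consumer instantiates `X₀ := CharacterModule ↥π.Sel₀`) -/

section Core

variable {A : Type} [CommRing A] [TopologicalSpace A] [IsDomain A] [IsDiscreteValuationRing A]
    [IsAdicComplete (IsLocalRing.maximalIdeal A) A] {V : Type} [AddCommGroup V] [Module A V] [TopologicalSpace V]
    [IsTopologicalAddGroup V] [ContinuousSMul A V] {T : GaloisRep ℚ A V} {p : ℕ} [Fact p.Prime]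
    {κ : ZpExtension ℚ p} {γ : Field.absoluteGaloisGroup ℚ} {I : IwasawaH1DataCoeff T p κ γ}
    [Module A I.H] [IsScalarTower A (PowerSeries A) I.H]
    (F : Type) [Field F] [Algebra A F] [IsFractionRing A F]

/-- **B⁻ — the `P`-free composite** («weakest sufficient = strongest honest» text of the algebraic hold child):
`𝐇¹_Γ/Λz₀` is `Λ`-torsion [Kato 12.4 (2), 12.5 (2), 12.6 — print] and `λ(𝐇¹_Γ/Λz₀) ≤ λ(X₀)`
[[BT26] Thm 2.6 ⊗ℚ ∘ Kurihara–Kobayashi 7.1 ii) Poitou–Tate at `(T_ρ, 2, 𝒪_λ)` — ONE composite print∘port clause].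
A RENDERING (generic Prop-valued predicate), nothing asserted.
[cite: BurungaleTian2026, Thm. 2.6 (p. 5)] [cite: Kato2004Asterisque, Thm. 12.4 (2), Thm. 12.5 (2), Thm. 12.6 (pp. 221–222)]
[cite: Kobayashi2003, Prop. 7.1 ii) (p. 12)] -/
def CompositeB (z₀ : I.H) (X₀ : Type) [AddCommGroup X₀] [Module A X₀] : Prop :=
  Module.IsTorsion (PowerSeries A) (I.H ⧸ Submodule.span (PowerSeries A) {z₀}) ∧
    Module.finrank F (F ⊗[A] (I.H ⧸ Submodule.span (PowerSeries A) {z₀})) ≤ Module.finrank F (F ⊗[A] X₀)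

/-- **B — the pen's child-B body** (KZG-HOLD-OPENING-SCOPE-g19 §2, generic rendering; `λ(P.H2)` can only be
SAID through `RestrictScalars A Λ P.H2` because `P` is `∃`-bound and `P.H2` carries no `A`-structure).
A RENDERING (generic Prop-valued predicate), nothing asserted.
[cite: BurungaleTian2026, Thm. 2.6 (p. 5)] [cite: Kato2004Asterisque, Thm. 12.4 (1)(2), Thm. 12.5 (2), Thm. 12.6 (pp. 221–222)] -/
def PenChildB (z₀ : I.H) (X₀ : Type) [AddCommGroup X₀] [Module A X₀] : Prop :=
  ∃ P : ZetaQuotientPackage I, z₀ ∈ P.Z ∧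
    (∃ c₀ : A, c₀ ≠ 0 ∧ ∀ y ∈ P.Z, c₀ • y ∈ Submodule.span (PowerSeries A) {z₀}) ∧
    P.CharIdealEqUpToConst ∧
    Module.finrank F (F ⊗[A] RestrictScalars A (PowerSeries A) P.H2) ≤ Module.finrank F (F ⊗[A] X₀)

/-! ## §2 The tautological package: `B⁻ → B`, and [BT26]'s conjunct is `rfl` -/

/-- `P₀(N) := ⟨H2 := 𝐇¹_Γ ⧸ N, Z := N⟩` — every field of Kato's package is inhabited by the zeta quotient itself. -/
def tautPackage (hI : Module.Finite (PowerSeries A) I.H) (N : Submodule (PowerSeries A) I.H)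
    (hN : Module.IsTorsion (PowerSeries A) (I.H ⧸ N)) : ZetaQuotientPackage I where
  H2 := I.H ⧸ N
  finite_H2 := by haveI := hI; infer_instance
  isTorsion_H2 := hN
  Z := N
  isTorsion_quotient := hN

omit [IsAdicComplete (IsLocalRing.maximalIdeal A) A] [Module A I.H] [IsScalarTower A (PowerSeries A) I.H] in
/-- On `P₀(N)` the [BT26] clause `(c)·char 𝐇² = (d)·char(𝐇¹/Z)` holds with `c = d = 1` BY `rfl`: it certifies nothing. -/
theorem tautPackage_charIdealEqUpToConst (hI : Module.Finite (PowerSeries A) I.H) (N : Submodule (PowerSeries A) I.H)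
    (hN : Module.IsTorsion (PowerSeries A) (I.H ⧸ N)) : (tautPackage hI N hN).CharIdealEqUpToConst :=
  ZetaQuotientPackage.charIdealEqUpToConst_of_eq _ rfl

omit [IsAdicComplete (IsLocalRing.maximalIdeal A) A] [IsFractionRing A F] in
/-- **`B⁻ → B`**: the composite inhabits the pen's text through the tautological package (`z₀ ∈ Λz₀`, `c₀ = 1`,
[BT26] by `rfl`, `hPT` = the composite inequality after instance transport). -/
theorem penChildB_of_compositeB (hI : Module.Finite (PowerSeries A) I.H) (z₀ : I.H)
    (X₀ : Type) [AddCommGroup X₀] [Module A X₀] (h : CompositeB F z₀ X₀) : PenChildB F z₀ X₀ := by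
  refine ⟨tautPackage hI _ h.1, Submodule.mem_span_singleton_self z₀,
    ⟨1, one_ne_zero, fun y hy => by rwa [one_smul]⟩, tautPackage_charIdealEqUpToConst hI _ h.1, ?_⟩
  have ht := finrank_baseChange_restrictScalars_eq (A := A) F (Λ := PowerSeries A) (I.H ⧸ Submodule.span (PowerSeries A) {z₀})
  change Module.finrank F (F ⊗[A] RestrictScalars A (PowerSeries A) (I.H ⧸ Submodule.span (PowerSeries A) {z₀})) ≤ _
  rw [ht]
  exact h.2

/-! ## §3 `B → B⁻`: constants and the package wash out (k2-g16 §1–§2 + the landed one-sided [BT26] flank) -/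

/-- Torsion transfer: `H/Z` torsion and `a • Z ≤ N` (`a ≠ 0`) ⇒ `H/N` torsion (k2-g16 §1, copied). [folklore] -/
theorem isTorsion_quotient_of_smul_le {R : Type*} [CommRing R] [IsDomain R] {H : Type*} [AddCommGroup H]
    [Module R H] {N Z : Submodule R H} (a : R) (ha : a ≠ 0) (haZ : ∀ z ∈ Z, a • z ∈ N)
    (hZ : Module.IsTorsion R (H ⧸ Z)) : Module.IsTorsion R (H ⧸ N) := by
  intro x
  induction x using Submodule.Quotient.induction_on with
  | H y =>
    obtain ⟨⟨b, hb⟩, hby⟩ := @hZ (Z.mkQ y)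
    rw [Submonoid.mk_smul, Submodule.mkQ_apply, ← Submodule.Quotient.mk_smul,
      Submodule.Quotient.mk_eq_zero] at hby
    refine ⟨⟨a * b, mem_nonZeroDivisors_of_ne_zero (mul_ne_zero ha (nonZeroDivisors.ne_zero hb))⟩, ?_⟩
    rw [Submonoid.mk_smul, ← Submodule.Quotient.mk_smul, Submodule.Quotient.mk_eq_zero, mul_smul]
    exact haZ _ hby

omit [IsDomain A] [IsDiscreteValuationRing A] [IsAdicComplete (IsLocalRing.maximalIdeal A) A] [IsFractionRing A F] in
/-- A constant isogeny is λ-invisible: `λ(H/N) = λ(H/Z)` for `N ≤ Z`, `c • Z ≤ N`, `c ∈ A ∖ 0` (k2-g16 §2, copied;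
`LambdaLowerBoundO.finrank_baseChange_eq_of_surjective_of_smul_ker_eq_zero`). [folklore] -/
theorem finrank_baseChange_quotient_eq_of_smul_le' {N Z : Submodule (PowerSeries A) I.H} (hle : N ≤ Z) (c : A)
    (hc : IsUnit (algebraMap A F c)) (hcZ : ∀ z ∈ Z, c • z ∈ N) :
    Module.finrank F (F ⊗[A] (I.H ⧸ N)) = Module.finrank F (F ⊗[A] (I.H ⧸ Z)) := by
  refine LambdaLowerBoundO.finrank_baseChange_eq_of_surjective_of_smul_ker_eq_zero F
    ((Submodule.factor hle).restrictScalars A) (Submodule.factor_surjective hle) c hc ?_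
  intro x hx
  obtain ⟨h, rfl⟩ := Submodule.Quotient.mk_surjective N x
  rw [LinearMap.mem_ker, LinearMap.restrictScalars_apply] at hx
  change Submodule.factor hle (N.mkQ h) = 0 at hx
  rw [Submodule.factor_mk, Submodule.mkQ_apply, Submodule.Quotient.mk_eq_zero] at hx
  rw [← Submodule.Quotient.mk_smul, Submodule.Quotient.mk_eq_zero]
  exact hcZ h hx

/-- **`B → B⁻`**: from ANY package `P` of the pen's text, `𝐇¹/Λz₀` is torsion (`c₀`-transfer from `P.isTorsion_quotient`)
and `λ(𝐇¹/Λz₀) = λ(𝐇¹/P.Z) ≤ λ(P.H2) ≤ λ(X₀)` (constants wash out; landed one-sided [BT26] flank; `hPT`). -/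
theorem compositeB_of_penChildB (hI : Module.Finite (PowerSeries A) I.H) (z₀ : I.H)
    (X₀ : Type) [AddCommGroup X₀] [Module A X₀] (h : PenChildB F z₀ X₀) : CompositeB F z₀ X₀ := by
  obtain ⟨P, hz₀, ⟨c₀, hc₀, hgen⟩, hBT, hPT⟩ := h
  haveI := hI
  set Λz := Submodule.span (PowerSeries A) {z₀} with hΛz
  have hleZ : Λz ≤ P.Z := by
    rw [hΛz, Submodule.span_singleton_le_iff_mem]; exact hz₀
  have hCc₀ : (PowerSeries.C c₀ : PowerSeries A) ≠ 0 := fun h =>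
    hc₀ (PowerSeries.C_injective (by rw [h, map_zero]))
  have hgenΛ : ∀ z ∈ P.Z, (PowerSeries.C c₀ : PowerSeries A) • z ∈ Λz := fun z hz => by
    rw [PowerSeries.C_eq_algebraMap, algebraMap_smul]; exact hgen z hz
  have htors : Module.IsTorsion (PowerSeries A) (I.H ⧸ Λz) :=
    isTorsion_quotient_of_smul_le (PowerSeries.C c₀) hCc₀ hgenΛ P.isTorsion_quotient
  refine ⟨htors, ?_⟩
  have hunit : IsUnit (algebraMap A F c₀) := by
    refine isUnit_iff_ne_zero.mpr fun h => hc₀ (IsFractionRing.injective A F ?_)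
    rw [h, map_zero]
  have h1 : Module.finrank F (F ⊗[A] (I.H ⧸ Λz)) = Module.finrank F (F ⊗[A] (I.H ⧸ P.Z)) :=
    finrank_baseChange_quotient_eq_of_smul_le' F hleZ c₀ hunit hgen
  -- the `A`-structure on the abstract `P.H2` is the restricted one (the only one the pen's text can mean)
  letI instM : Module A P.H2 := (inferInstance : Module A (RestrictScalars A (PowerSeries A) P.H2))
  letI : IsScalarTower A (PowerSeries A) P.H2 :=
    ⟨fun a l x => by
      change (a • l) • x = (algebraMap A (PowerSeries A) a) • (l • x)
      rw [Algebra.smul_def, mul_smul]⟩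
  have hP : ∃ c d : A, c ≠ 0 ∧ d ≠ 0 ∧
      Ideal.span {PowerSeries.C c} * P.charH2 ≤ Ideal.span {PowerSeries.C d} * P.charZetaQuotient := by
    obtain ⟨c, d, hc, hd, he⟩ := hBT.exists_const_mul_eq
    exact ⟨c, d, hc, hd, he.le⟩
  have h2 := CharIdealLambda.finrank_baseChange_zetaQuotient_le_H2_of_span_C_mul_charIdeal_le hI P hP F
  calc Module.finrank F (F ⊗[A] (I.H ⧸ Λz))
      = Module.finrank F (F ⊗[A] (I.H ⧸ P.Z)) := h1
    _ ≤ Module.finrank F (F ⊗[A] P.H2) := h2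
    _ ≤ Module.finrank F (F ⊗[A] X₀) := hPT

/-- **`B ↔ B⁻`** — the pen's algebraic child is EQUIVALENT to its `P`-free composite: under `∃ P` the conjuncts
`z₀ ∈ P.Z`, `c₀ • P.Z ⊆ Λz₀` and `P.CharIdealEqUpToConst` are decoration. -/
theorem penChildB_iff_compositeB (hI : Module.Finite (PowerSeries A) I.H) (z₀ : I.H)
    (X₀ : Type) [AddCommGroup X₀] [Module A X₀] : PenChildB F z₀ X₀ ↔ CompositeB F z₀ X₀ :=
  ⟨compositeB_of_penChildB F hI z₀ X₀, penChildB_of_compositeB F hI z₀ X₀⟩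

/-! ## §4 The consumer needs no package: `(ii_fin) ∧ (ii_D′)` of S3″ for `z := D • z₀` straight from `B⁻` -/

/-- **`(ii)`-clauses from the composite** (k2-g16's `ii_clauses_of_package` with the package, `hP`, `hgen`, `hPT`
replaced by `B⁻`): `F ⊗ 𝐇¹_Γ/Λ(D•z₀)` is finite-dimensional and `λ(𝐇¹_Γ/Λ(D•z₀)) ≤ λ(X₀) + λ(Λ/(D))`. -/
theorem ii_clauses_of_compositeB (hI : Module.Finite (PowerSeries A) I.H) (z₀ : I.H)
    (hz₀tf : ∀ a : PowerSeries A, a • z₀ = 0 → a = 0) (D : PowerSeries A) (hD : D ≠ 0)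
    (X₀ : Type) [AddCommGroup X₀] [Module A X₀] (h : CompositeB F z₀ X₀) :
    Module.Finite F (F ⊗[A] (I.H ⧸ Submodule.span (PowerSeries A) {D • z₀})) ∧
      Module.finrank F (F ⊗[A] (I.H ⧸ Submodule.span (PowerSeries A) {D • z₀})) ≤
        Module.finrank F (F ⊗[A] X₀) + Module.finrank F (F ⊗[A] (PowerSeries A ⧸ Ideal.span {D})) := by
  haveI := hI
  obtain ⟨htors, hle⟩ := h
  have htorsD : Module.IsTorsion (PowerSeries A) (I.H ⧸ Submodule.span (PowerSeries A) {D • z₀}) := by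
    refine isTorsion_quotient_of_smul_le D hD (fun z hz => ?_) htors
    rw [Submodule.mem_span_singleton] at hz
    obtain ⟨b, rfl⟩ := hz
    rw [smul_smul, mul_comm, ← smul_smul]
    exact Submodule.smul_mem _ _ (Submodule.mem_span_singleton_self _)
  have hfin : Module.Finite F (F ⊗[A] (I.H ⧸ Submodule.span (PowerSeries A) {D • z₀})) :=
    CharIdealLambda.finite_baseChange_of_isTorsion F _ htorsD
  have h2 := CharIdealLambda.finrank_baseChange_quotient_span_smul_eq_add F z₀ hz₀tf D hD htors
  exact ⟨hfin, by omega⟩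

end Core

end Summit.BirchSwinnertonDyer.BirchSwinnertonDyer.Cruxes.ResidualThetaCountLowerPureAtTwo.SideaK1G24

end
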